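import Mathlib
import HarnessLib
import Summits.HubbardSuperconductivity.HubbardSuperconductivity.Theorems.KLProgrammeKLRegimeEngineV8DefsG4

/-!
# K3 engine package, `G`-level v5: `klEngGeo5 := klEngGeo4.scaleGains (2 ^ 28)` — the GAINS RIDER (κg) on top of DefsG4

Cell `gate-hubbard-kl`, seat hubbard-kl-k3c2-p2 g5 (author of the gains rider, STATUS 2026-08-27 05:09Z; plan g14 (R11-HOLD) 05:30Z: «the swap
target must carry every named rider … shape `klEngGeo5 := { klEngGeo4 with ppGain := …, phGain := …, CF := … }` + `klEngGeo5_wf` ported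
clause-wise … in a `…EngineV8DefsG5.lean` that imports DefsG4»).  WHY (NIT-κg, kl-ref g34; k3c2-p2 gen-3 NUMBER NOTE; k3c1-p2 g6 audit cell):
the two-shell gain profiles `ppGainOf` / `phGainOf` of `klEngGeo3/4` carry a hard cap `min 1 …` / `else 1`, so at in-class particle–particle
transfers (every `n`) and at particle–hole transfers for `n ≤ 12` the value clauses (E2″-v6) `PairValueIncrementAtV6`, (E2′-S3)
`QuarticValueIncrementAtS3` and the (X) line of (E2-v9) `PairLadderStepAtV9` must absorb `(Klam U)² × (sign-blind rung / bubble mass)` under a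
budget of exactly `(Klam U)²·1`, while no landed lemma certifies that mass `≤ 1` (count × count ≈ `bhi`-scale, `klsb2_*` ≈ 2^8, the sharp
`klrm_/klrp_/klrq_/klrl_*` ≈ `0.22·B_W` mid-ladder but `klsb2`-grade in the β-layer).  The rider multiplies BOTH gain profiles by
`κg = 2^28 = 16·bhi` and the freezing constant `CF` by the same factor (so `GeoConsts.WF`'s two gain-sum clauses port by `mul_le_mul_of_nonneg_left`):

* §1 (generic, ns `…KLRegimeSplit`) **`GeoConsts.scaleGains G κ := { G with ppGain := κ·G.ppGain, phGain := κ·G.phGain, CF := κ·G.CF }`**, `rfl`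
  lemmas for every untouched field, **`GeoConsts.scaleGains_wf : G.WF → 1 ≤ κ → (G.scaleGains κ).WF`**, monotonicity of the gains / `CF` /
  `gainBar` / `thermalBar`, the untouched majorants (`initDevBar`, `legDressBarQ`, `eremBar`, `driveBar`, `drivePBar`, `klEdge`, `twoLegBar`,
  `bflBar`, `lipBar`, `Bcum`), and the COVARIANT transfer of every conjunct of the V9 engine slot, **`engineBoundsAtV9S_scaleGains_of`**
  (`G.WF`, `1 ≤ κ`, `0 ≤ P.Klam`);
* §2 (ns `…EngineV8`) **`klEngGeo5 := klEngGeo4.scaleGains (2 ^ 28)`**, **`klEngGeo5_wf`**, field lemmas (`klEngGeo5_ppGain_apply`,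
  `klEngGeo5_phGain_apply`, `klEngGeo5_CF`, `klEngGeo5_cE4`, untouched fields `rfl`), the consumers' inequalities
  (`klIsoT_pow_four_le_klEngGeo5_CF`, `klE4T_le_klEngGeo5_cE4`, `two_pow_le_klEngGeo5_CF : 2^80 ≤ CF`, `klEngGeo5_ppGain_zero : ppGain n 0 = 2^28`),
  and the transfers `engineBoundsAtV9S_klEngGeo5_of_klEngGeo4 / _of_klEngGeo3`.

(R3)-legality: gains and `CF` are pure upper-bound fields (read covariantly by every engine clause, by `GeoConsts.WF` only as `0 ≤ ·` and as the
bound of the two gain sums); child 1 is closed `∀ G, G.WF`.  Definitions with bodies + proved lemmas; nothing about the model is asserted.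
FILED on the planner's word: plan g14 (R12) RULING (STATUS l.2049, 05:56:26Z; gen-6 `--resplit`, engine child born with G5) and GO LINE
«k3c2-p2: file DefsG5» (STATUS l.2058, 06:01:47Z); seat hubbard-kl-k3c2-p2 g6 files the g5 draft e33b23fbf655dbb5 with two docstring corrections.
-/

noncomputable section

namespace Summit.HubbardSuperconductivity.HubbardSuperconductivity.Theorems.KLRegimeSplit

set_option linter.dupNamespace false -- summit = problem name (single-conjunct summit), D-0017

open Real Finset Literature.MathematicalPhysics.QuantumLattice Literature.Probability.LatticeModels
open Summit.HubbardSuperconductivity.HubbardSuperconductivity.Theorems.KLProgrammeLegKernels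

/-! ## §1 Scaling the gains of a geometric package -/

/-- **`G.scaleGains κ`** — the geometric package `G` with both two-shell gain profiles and the freezing constant multiplied by `κ`
(`ppGain := κ·G.ppGain`, `phGain := κ·G.phGain`, `CF := κ·G.CF`), every other field untouched. -/
def GeoConsts.scaleGains (G : GeoConsts) (κ : ℝ) : GeoConsts :=
  { G with ppGain := fun n ρ => κ * G.ppGain n ρ, phGain := fun n ρ => κ * G.phGain n ρ, CF := κ * G.CF }

namespace GeoConsts

variable (G : GeoConsts) (κ : ℝ)

/-- `(G.scaleGains κ).ppGain n ρ = κ·G.ppGain n ρ`. -/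
theorem scaleGains_ppGain (n : ℕ) (ρ : ℝ) : (G.scaleGains κ).ppGain n ρ = κ * G.ppGain n ρ := rfl
/-- `(G.scaleGains κ).phGain n ρ = κ·G.phGain n ρ`. -/
theorem scaleGains_phGain (n : ℕ) (ρ : ℝ) : (G.scaleGains κ).phGain n ρ = κ * G.phGain n ρ := rfl
/-- `(G.scaleGains κ).CF = κ·G.CF`. -/
theorem scaleGains_CF : (G.scaleGains κ).CF = κ * G.CF := rfl
/-- untouched field `cE4`. -/
theorem scaleGains_cE4 : (G.scaleGains κ).cE4 = G.cE4 := rfl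
/-- untouched field `atop`. -/
theorem scaleGains_atop : (G.scaleGains κ).atop = G.atop := rfl
/-- untouched field `abot`. -/
theorem scaleGains_abot : (G.scaleGains κ).abot = G.abot := rfl
/-- untouched field `blo`. -/
theorem scaleGains_blo : (G.scaleGains κ).blo = G.blo := rfl
/-- untouched field `bhi`. -/
theorem scaleGains_bhi : (G.scaleGains κ).bhi = G.bhi := rfl
/-- untouched field `cloc`. -/
theorem scaleGains_cloc : (G.scaleGains κ).cloc = G.cloc := rfl
/-- untouched field `θ`. -/
theorem scaleGains_θ : (G.scaleGains κ).θ = G.θ := rfl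
/-- untouched field `a`. -/
theorem scaleGains_a : (G.scaleGains κ).a = G.a := rfl
/-- untouched field `ζ`. -/
theorem scaleGains_ζ : (G.scaleGains κ).ζ = G.ζ := rfl
/-- untouched field `Z`. -/
theorem scaleGains_Z : (G.scaleGains κ).Z = G.Z := rfl
/-- untouched field `aplus`. -/
theorem scaleGains_aplus : (G.scaleGains κ).aplus = G.aplus := rfl
/-- untouched field `S`. -/
theorem scaleGains_S : (G.scaleGains κ).S = G.S := rfl
/-- untouched field `Bf`. -/
theorem scaleGains_Bf : (G.scaleGains κ).Bf = G.Bf := rfl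
/-- untouched field `SL`. -/
theorem scaleGains_SL : (G.scaleGains κ).SL = G.SL := rfl

variable {G κ}

/-- **Scaling the gains preserves well-formedness** for `κ ≥ 1`: nonnegativity of the gains and of `CF` is kept, and the two gain-sum clauses
`Σ gain ≤ CF` scale by `κ` on both sides. -/
theorem scaleGains_wf (hG : G.WF) (hκ : 1 ≤ κ) : (G.scaleGains κ).WF := by
  have hκ0 : 0 ≤ κ := le_trans zero_le_one hκ
  obtain ⟨h1, h2, h3, h4, h5, h6, h7, h8, h9, h10, h11, h12, h13, h14, h15, h16, h17, h18, h19, h20⟩ := hG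
  refine ⟨h1, h2, h3, h4, h5, h6, h7, h8, h9, h10, h11, ?_, ?_, ?_, ?_, ?_, h17, h18, h19, h20⟩
  · exact fun n ρ => mul_nonneg hκ0 (h12 n ρ)
  · exact fun n ρ => mul_nonneg hκ0 (h13 n ρ)
  · exact mul_nonneg hκ0 h14
  · intro ρ N hρ
    show ∑ n ∈ range N, κ * G.phGain n ρ ≤ κ * G.CF
    rw [← mul_sum]
    exact mul_le_mul_of_nonneg_left (h15 ρ N hρ) hκ0
  · intro ρ t N hρ
    show ∑ n ∈ Ioc t N, κ * G.ppGain n ρ ≤ κ * G.CF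
    rw [← mul_sum]
    exact mul_le_mul_of_nonneg_left (h16 ρ t N hρ) hκ0

/-- The particle–particle gain grows: `G.ppGain n ρ ≤ (G.scaleGains κ).ppGain n ρ` (`0 ≤ G.ppGain`, `1 ≤ κ`). -/
theorem ppGain_le_scaleGains (hpp : ∀ n ρ, 0 ≤ G.ppGain n ρ) (hκ : 1 ≤ κ) (n : ℕ) (ρ : ℝ) :
    G.ppGain n ρ ≤ (G.scaleGains κ).ppGain n ρ :=
  le_mul_of_one_le_left (hpp n ρ) hκ

/-- The particle–hole gain grows. -/
theorem phGain_le_scaleGains (hph : ∀ n ρ, 0 ≤ G.phGain n ρ) (hκ : 1 ≤ κ) (n : ℕ) (ρ : ℝ) :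
    G.phGain n ρ ≤ (G.scaleGains κ).phGain n ρ :=
  le_mul_of_one_le_left (hph n ρ) hκ

/-- The freezing constant grows. -/
theorem CF_le_scaleGains (hCF : 0 ≤ G.CF) (hκ : 1 ≤ κ) : G.CF ≤ (G.scaleGains κ).CF :=
  le_mul_of_one_le_left hCF hκ

end GeoConsts

/-! ### The majorants under `scaleGains` -/

section Bars

variable (G : GeoConsts) (κ : ℝ) (P : SplitConsts) (Q : EngConsts)

/-- `initDevBar` does not read the gains or `CF`. -/
theorem initDevBar_scaleGains (U : ℝ) : initDevBar (G.scaleGains κ) U = initDevBar G U := rfl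
/-- `legDressBarQ` does not read `G`. -/
theorem legDressBarQ_scaleGains (U : ℝ) (n c : ℕ) : legDressBarQ (G.scaleGains κ) P Q U n c = legDressBarQ G P Q U n c := rfl
/-- `eremBar` reads only `cloc`, `θ`. -/
theorem eremBar_scaleGains (U β : ℝ) (L n : ℕ) : eremBar (G.scaleGains κ) P Q U β L n = eremBar G P Q U β L n := rfl
/-- `driveBar` reads only `a`, `ζ`. -/
theorem driveBar_scaleGains (U : ℝ) (χ : D4Irrep) (n : ℕ) : driveBar (G.scaleGains κ) U χ n = driveBar G U χ n := rfl
/-- `drivePBar` reads only `aplus`, `ζ`. -/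
theorem drivePBar_scaleGains (U : ℝ) (n : ℕ) : drivePBar (G.scaleGains κ) P U n = drivePBar G P U n := rfl
/-- `klEdge` reads only `bhi`. -/
theorem klEdge_scaleGains (n : ℕ) (ρ : ℝ) : klEdge (G.scaleGains κ) n ρ = klEdge G n ρ := rfl
/-- `twoLegBar` reads only `S`. -/
theorem twoLegBar_scaleGains (U : ℝ) (j n : ℕ) : twoLegBar (G.scaleGains κ) Q U j n = twoLegBar G Q U j n := rfl
/-- `bflBar` reads only `Bf`, `θ`. -/
theorem bflBar_scaleGains (U : ℝ) (n : ℕ) : bflBar (G.scaleGains κ) Q U n = bflBar G Q U n := rfl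
/-- `lipBar` reads only `SL`. -/
theorem lipBar_scaleGains (U : ℝ) (n : ℕ) : lipBar (G.scaleGains κ) Q U n = lipBar G Q U n := rfl
/-- `Bcum` reads only `bhi`. -/
theorem Bcum_scaleGains (n : ℕ) : Bcum (G.scaleGains κ) n = Bcum G n := rfl

variable {G κ}

/-- **`gainBar` grows** under `scaleGains` (`0 ≤ gains`, `1 ≤ κ`). -/
theorem gainBar_le_scaleGains (hpp : ∀ n ρ, 0 ≤ G.ppGain n ρ) (hph : ∀ n ρ, 0 ≤ G.phGain n ρ) (hκ : 1 ≤ κ) (U : ℝ) (n : ℕ)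
    (ρpp ρd ρx : ℝ) : gainBar G P U n ρpp ρd ρx ≤ gainBar (G.scaleGains κ) P U n ρpp ρd ρx := by
  unfold gainBar
  have h1 := GeoConsts.ppGain_le_scaleGains hpp hκ n ρpp
  have h2 := GeoConsts.phGain_le_scaleGains hph hκ n ρd
  have h3 := GeoConsts.phGain_le_scaleGains hph hκ n ρx
  exact mul_le_mul_of_nonneg_left (by linarith) (sq_nonneg _)

/-- **`thermalBar` grows** under `scaleGains` (`0 ≤ CF`, `1 ≤ κ`). -/
theorem thermalBar_le_scaleGains (hCF : 0 ≤ G.CF) (hκ : 1 ≤ κ) (U β : ℝ) (n : ℕ) :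
    thermalBar G P U β n ≤ thermalBar (G.scaleGains κ) P U β n :=
  thermalBar_mono (GeoConsts.CF_le_scaleGains hCF hκ) P U β n

end Bars

/-! ### The engine slot under `scaleGains` -/

section Model

variable {L M : ℕ} [NeZero L] [NeZero M] {G : GeoConsts} {κ : ℝ} {P : SplitConsts} {Q : EngConsts} {β U μ : ℝ} {K : TrigPolyC4v}
  {n : ℕ}

/-- **(E2′-S2 UV) is unchanged by `scaleGains`.** -/
theorem quarticValueUVAtS2_scaleGains_iff (κ : ℝ) :
    QuarticValueUVAtS2 L M (G.scaleGains κ) P Q β U μ K n ↔ QuarticValueUVAtS2 L M G P Q β U μ K n := by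
  simp only [QuarticValueUVAtS2, initDevBar_scaleGains, legDressBarQ_scaleGains]

/-- **(E2-v9) transfers to `scaleGains`** (`G.WF`, `1 ≤ κ`): the scale-`0` clause is unchanged; the step clause's budget grows through `thermalBar`
and the (X) line `(Klam U)²·(phGain + phGain)`. -/
theorem pairLadderStepAtV9_scaleGains_of (hG : G.WF) (hκ : 1 ≤ κ) (h : PairLadderStepAtV9 L M G P Q β U μ K n) :
    PairLadderStepAtV9 L M (G.scaleGains κ) P Q β U μ K n := by
  have hph : ∀ m ρ, 0 ≤ G.phGain m ρ := hG.2.2.2.2.2.2.2.2.2.2.2.2.1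
  have hCF : 0 ≤ G.CF := hG.2.2.2.2.2.2.2.2.2.2.2.2.2.1
  obtain ⟨h0, hs⟩ := h
  refine ⟨fun hn Qm k hk k' hk' => ?_, fun hn Qm hQm => ?_⟩
  · rw [initDevBar_scaleGains, legDressBarQ_scaleGains]
    exact h0 hn Qm k hk k' hk'
  · obtain ⟨w, hw1, hw2, N, hN, hb⟩ := hs hn Qm hQm
    refine ⟨w, hw1, ?_, N, hN, fun k hk k' hk' => (hb k hk k' hk').trans ?_⟩
    · rw [klEdge_scaleGains]; exact hw2
    · rw [drivePBar_scaleGains, eremBar_scaleGains, legDressBarQ_scaleGains]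
      have hth := thermalBar_le_scaleGains (P := P) hCF hκ U β n
      have h1 := GeoConsts.phGain_le_scaleGains hph hκ n (klTorusNorm L (k - k'))
      have h2 := GeoConsts.phGain_le_scaleGains hph hκ n (klTorusNorm L (k + k' - Qm))
      have hsq : 0 ≤ (P.Klam * U) ^ 2 := sq_nonneg _
      nlinarith

/-- **(E2″-v6) transfers to `scaleGains`** (`gainBar`, `thermalBar` grow; `eremBar`, `legDressBarQ` unchanged). -/
theorem pairValueIncrementAtV6_scaleGains_of (hG : G.WF) (hκ : 1 ≤ κ) (h : PairValueIncrementAtV6 L M G P Q β U μ K n) :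
    PairValueIncrementAtV6 L M (G.scaleGains κ) P Q β U μ K n := by
  have hpp : ∀ m ρ, 0 ≤ G.ppGain m ρ := hG.2.2.2.2.2.2.2.2.2.2.2.1
  have hph : ∀ m ρ, 0 ≤ G.phGain m ρ := hG.2.2.2.2.2.2.2.2.2.2.2.2.1
  have hCF : 0 ≤ G.CF := hG.2.2.2.2.2.2.2.2.2.2.2.2.2.1
  intro hn Qm k hk k' hk'
  refine (h hn Qm k hk k' hk').trans ?_
  rw [eremBar_scaleGains, legDressBarQ_scaleGains]
  have h1 := gainBar_le_scaleGains (P := P) hpp hph hκ U n (klTorusNorm L Qm) (klTorusNorm L (k - k')) (klTorusNorm L (k + k' - Qm))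
  have h2 := thermalBar_le_scaleGains (P := P) hCF hκ U β n
  linarith

/-- **(E2′-S3) transfers to `scaleGains`.** -/
theorem quarticValueIncrementAtS3_scaleGains_of (hG : G.WF) (hκ : 1 ≤ κ) (h : QuarticValueIncrementAtS3 L M G P Q β U μ K n) :
    QuarticValueIncrementAtS3 L M (G.scaleGains κ) P Q β U μ K n := by
  have hpp : ∀ m ρ, 0 ≤ G.ppGain m ρ := hG.2.2.2.2.2.2.2.2.2.2.2.1
  have hph : ∀ m ρ, 0 ≤ G.phGain m ρ := hG.2.2.2.2.2.2.2.2.2.2.2.2.1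
  have hCF : 0 ≤ G.CF := hG.2.2.2.2.2.2.2.2.2.2.2.2.2.1
  intro hn k₁ hk₁ k₂ hk₂ k₃ hk₃
  refine (h hn k₁ hk₁ k₂ hk₂ k₃ hk₃).trans ?_
  rw [eremBar_scaleGains, legDressBarQ_scaleGains]
  have h1 := gainBar_le_scaleGains (P := P) hpp hph hκ U n (klTorusNorm L (k₁ + k₃)) (klTorusNorm L (k₁ - k₂)) (klTorusNorm L (k₂ - k₃))
  have h2 := thermalBar_le_scaleGains (P := P) hCF hκ U β n
  linarith

/-- **(E4) transfers to `scaleGains`** (`cE4` untouched; `0 ≤ P.Klam`). -/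
theorem engineFirstMoments_scaleGains_of (κ : ℝ) (hK : 0 ≤ P.Klam) (h : EngineFirstMoments L M G P Q β U μ K n) :
    EngineFirstMoments L M (G.scaleGains κ) P Q β U μ K n :=
  engineFirstMoments_mono (le_of_eq (GeoConsts.scaleGains_cE4 G κ).symm) hK h

/-- **(E5-S) transfers to `scaleGains`** (`CF` grows). -/
theorem isoTupleL1AtS_scaleGains_of (hCF : 0 ≤ G.CF) (hκ : 1 ≤ κ) (h : IsoTupleL1AtS L M G P β U μ K n) :
    IsoTupleL1AtS L M (G.scaleGains κ) P β U μ K n :=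
  isoTupleL1AtS_mono (GeoConsts.CF_le_scaleGains hCF hκ) h

/-- **The whole V9 engine slot transfers to `scaleGains`**: `EngineBoundsAtV9S … G … n → EngineBoundsAtV9S … (G.scaleGains κ) … n`
(`G.WF`, `1 ≤ κ`, `0 ≤ P.Klam`; (E0) and (E1-v4) do not read `G`). -/
theorem engineBoundsAtV9S_scaleGains_of (hG : G.WF) (hκ : 1 ≤ κ) (hK : 0 ≤ P.Klam) (h : EngineBoundsAtV9S L M G P Q β U μ K n) :
    EngineBoundsAtV9S L M (G.scaleGains κ) P Q β U μ K n := by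
  have hCF : 0 ≤ G.CF := hG.2.2.2.2.2.2.2.2.2.2.2.2.2.1
  obtain ⟨h0, h1, h2, h3, h4, h5, h6, h7⟩ := h
  exact ⟨h0, h1, pairLadderStepAtV9_scaleGains_of hG hκ h2, pairValueIncrementAtV6_scaleGains_of hG hκ h3,
    quarticValueIncrementAtS3_scaleGains_of hG hκ h4, (quarticValueUVAtS2_scaleGains_iff κ).2 h5,
    engineFirstMoments_scaleGains_of κ hK h6, isoTupleL1AtS_scaleGains_of hCF hκ h7⟩

end Model

end Summit.HubbardSuperconductivity.HubbardSuperconductivity.Theorems.KLRegimeSplit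

/-! ## §2 The v5 package `klEngGeo5 := klEngGeo4.scaleGains (2 ^ 28)` -/

namespace Summit.HubbardSuperconductivity.HubbardSuperconductivity.Theorems.EngineV8

set_option linter.dupNamespace false -- summit = problem name (single-conjunct summit), D-0017

open Real Finset Literature.MathematicalPhysics.QuantumLattice Literature.Probability.LatticeModels
open Summit.HubbardSuperconductivity.HubbardSuperconductivity.Theorems.KLRegimeSplit

/-- **`klEngGeo5` — the engine's absolute constants `G`, v5**: `klEngGeo4` with both gain profiles and `CF` multiplied by `κg = 2^28 = 16·bhi`. -/
def klEngGeo5 : GeoConsts := klEngGeo4.scaleGains (2 ^ 28)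

/-- `klEngGeo5 = klEngGeo4.scaleGains (2 ^ 28)` (`rfl`). -/
theorem klEngGeo5_eq_scaleGains : klEngGeo5 = klEngGeo4.scaleGains (2 ^ 28) := rfl

/-- **`klEngGeo5` is well formed.** -/
theorem klEngGeo5_wf : klEngGeo5.WF := GeoConsts.scaleGains_wf klEngGeo4_wf (by norm_num)

/-- `klEngGeo5.ppGain n ρ = 2^28 · ppGainOf 2^24 2^24 0 klE0 n n ρ`. -/
theorem klEngGeo5_ppGain_apply (n : ℕ) (ρ : ℝ) : klEngGeo5.ppGain n ρ = 2 ^ 28 * ppGainOf (2 ^ 24) (2 ^ 24) 0 klE0 n n ρ := rfl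

/-- `klEngGeo5.phGain n ρ = 2^28 · phGainOf 2^24 2^24 2^24 2^24 0 klE0 n n (max ρ 0)`. -/
theorem klEngGeo5_phGain_apply (n : ℕ) (ρ : ℝ) :
    klEngGeo5.phGain n ρ = 2 ^ 28 * phGainOf (2 ^ 24) (2 ^ 24) (2 ^ 24) (2 ^ 24) 0 klE0 n n (max ρ 0) := rfl

/-- `klEngGeo5.ppGain n ρ = 2^28 · klEngGeo4.ppGain n ρ`. -/
theorem klEngGeo5_ppGain_eq (n : ℕ) (ρ : ℝ) : klEngGeo5.ppGain n ρ = 2 ^ 28 * klEngGeo4.ppGain n ρ := rfl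

/-- `klEngGeo5.phGain n ρ = 2^28 · klEngGeo4.phGain n ρ`. -/
theorem klEngGeo5_phGain_eq (n : ℕ) (ρ : ℝ) : klEngGeo5.phGain n ρ = 2 ^ 28 * klEngGeo4.phGain n ρ := rfl

/-- `klEngGeo5.CF = 2^28 · klEngGeo4.CF`. -/
theorem klEngGeo5_CF : klEngGeo5.CF = 2 ^ 28 * klEngGeo4.CF := rfl

/-- `klEngGeo5.cE4 = klEngGeo4.cE4` (the (E4)₀ constant `klE4T` rides unchanged). -/
theorem klEngGeo5_cE4 : klEngGeo5.cE4 = klEngGeo4.cE4 := rfl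

/-- **The in-class particle–particle floor is now `2^28`**: `klEngGeo5.ppGain n 0 = 2^28` at every scale. -/
theorem klEngGeo5_ppGain_zero (n : ℕ) : klEngGeo5.ppGain n 0 = 2 ^ 28 := by
  rw [klEngGeo5_ppGain_apply]
  have : ppGainOf (2 ^ 24) (2 ^ 24) 0 klE0 n n 0 = 1 := by
    unfold ppGainOf
    rw [if_neg (by simp)]
  rw [this, mul_one]

/-- The gains grew: `klEngGeo4.ppGain n ρ ≤ klEngGeo5.ppGain n ρ`. -/
theorem klEngGeo4_ppGain_le_klEngGeo5_ppGain (n : ℕ) (ρ : ℝ) : klEngGeo4.ppGain n ρ ≤ klEngGeo5.ppGain n ρ :=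
  GeoConsts.ppGain_le_scaleGains klEngGeo4_wf.2.2.2.2.2.2.2.2.2.2.2.1 (by norm_num) n ρ

/-- `klEngGeo4.phGain n ρ ≤ klEngGeo5.phGain n ρ`. -/
theorem klEngGeo4_phGain_le_klEngGeo5_phGain (n : ℕ) (ρ : ℝ) : klEngGeo4.phGain n ρ ≤ klEngGeo5.phGain n ρ :=
  GeoConsts.phGain_le_scaleGains klEngGeo4_wf.2.2.2.2.2.2.2.2.2.2.2.2.1 (by norm_num) n ρ

/-- `klEngGeo4.CF ≤ klEngGeo5.CF`. -/
theorem klEngGeo4_CF_le_klEngGeo5_CF : klEngGeo4.CF ≤ klEngGeo5.CF :=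
  GeoConsts.CF_le_scaleGains klEngGeo4_wf.2.2.2.2.2.2.2.2.2.2.2.2.2.1 (by norm_num)

/-- **`klIsoT ^ 4 ≤ klEngGeo5.CF`** — the (E5-S)₀ closer's `hCF` input survives the rider. -/
theorem klIsoT_pow_four_le_klEngGeo5_CF : klIsoT ^ 4 ≤ klEngGeo5.CF :=
  klIsoT_pow_four_le_klEngGeo4_CF.trans klEngGeo4_CF_le_klEngGeo5_CF

/-- **`klE4T ≤ klEngGeo5.cE4`** — the (E4)₀ consumer's `hcE4` input survives the rider. -/
theorem klE4T_le_klEngGeo5_cE4 : klE4T ≤ klEngGeo5.cE4 := klEngGeo5_cE4 ▸ klE4T_le_klEngGeo4_cE4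

/-- `2 ^ 80 ≤ klEngGeo5.CF` (`2^28 · 2^52`). -/
theorem two_pow_le_klEngGeo5_CF : (2 : ℝ) ^ 80 ≤ klEngGeo5.CF := by
  rw [klEngGeo5_CF, show (2 : ℝ) ^ 80 = 2 ^ 28 * 2 ^ 52 by norm_num]
  exact mul_le_mul_of_nonneg_left two_pow_le_klEngGeo4_CF (by norm_num)

/-- untouched field `bhi`. -/
theorem klEngGeo5_bhi : klEngGeo5.bhi = klEngGeo4.bhi := rfl
/-- untouched field `S`. -/
theorem klEngGeo5_S : klEngGeo5.S = klEngGeo4.S := rfl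
/-- untouched field `SL`. -/
theorem klEngGeo5_SL : klEngGeo5.SL = klEngGeo4.SL := rfl
/-- untouched field `Bf`. -/
theorem klEngGeo5_Bf : klEngGeo5.Bf = klEngGeo4.Bf := rfl
/-- untouched field `aplus`. -/
theorem klEngGeo5_aplus : klEngGeo5.aplus = klEngGeo4.aplus := rfl
/-- untouched field `ζ`. -/
theorem klEngGeo5_ζ : klEngGeo5.ζ = klEngGeo4.ζ := rfl
/-- untouched field `Z`. -/
theorem klEngGeo5_Z : klEngGeo5.Z = klEngGeo4.Z := rfl
/-- untouched field `cloc`. -/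
theorem klEngGeo5_cloc : klEngGeo5.cloc = klEngGeo4.cloc := rfl
/-- untouched field `θ`. -/
theorem klEngGeo5_θ : klEngGeo5.θ = klEngGeo4.θ := rfl
/-- untouched field `a`. -/
theorem klEngGeo5_a : klEngGeo5.a = klEngGeo4.a := rfl
/-- untouched field `atop`. -/
theorem klEngGeo5_atop : klEngGeo5.atop = klEngGeo4.atop := rfl
/-- untouched field `abot`. -/
theorem klEngGeo5_abot : klEngGeo5.abot = klEngGeo4.abot := rfl
/-- untouched field `blo`. -/
theorem klEngGeo5_blo : klEngGeo5.blo = klEngGeo4.blo := rfl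

/-- **The V9 engine slot transfers from `klEngGeo4` to `klEngGeo5`** (`0 ≤ P.Klam`). -/
theorem engineBoundsAtV9S_klEngGeo5_of_klEngGeo4 {L M : ℕ} [NeZero L] [NeZero M] {P : SplitConsts} {Q : EngConsts} {β U μ : ℝ}
    {K : TrigPolyC4v} {n : ℕ} (hK : 0 ≤ P.Klam) (h : EngineBoundsAtV9S L M klEngGeo4 P Q β U μ K n) :
    EngineBoundsAtV9S L M klEngGeo5 P Q β U μ K n :=
  engineBoundsAtV9S_scaleGains_of klEngGeo4_wf (by norm_num) hK h

/-- **… and from `klEngGeo3`** (composition with `engineBoundsAtV9S_klEngGeo4_of_klEngGeo3`). -/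
theorem engineBoundsAtV9S_klEngGeo5_of_klEngGeo3 {L M : ℕ} [NeZero L] [NeZero M] {P : SplitConsts} {Q : EngConsts} {β U μ : ℝ}
    {K : TrigPolyC4v} {n : ℕ} (hK : 0 ≤ P.Klam) (h : EngineBoundsAtV9S L M klEngGeo3 P Q β U μ K n) :
    EngineBoundsAtV9S L M klEngGeo5 P Q β U μ K n :=
  engineBoundsAtV9S_klEngGeo5_of_klEngGeo4 hK (engineBoundsAtV9S_klEngGeo4_of_klEngGeo3 hK h)

/-- `IsoTupleL1AtS` transfers from `klEngGeo4` to `klEngGeo5`. -/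
theorem isoTupleL1AtS_klEngGeo5_of_klEngGeo4 {L M : ℕ} [NeZero L] [NeZero M] {P : SplitConsts} {β U μ : ℝ} {K : TrigPolyC4v} {n : ℕ}
    (h : IsoTupleL1AtS L M klEngGeo4 P β U μ K n) : IsoTupleL1AtS L M klEngGeo5 P β U μ K n :=
  isoTupleL1AtS_scaleGains_of klEngGeo4_wf.2.2.2.2.2.2.2.2.2.2.2.2.2.1 (by norm_num) h

/-- `EngineFirstMoments` transfers from `klEngGeo4` to `klEngGeo5` (`0 ≤ P.Klam`). -/
theorem engineFirstMoments_klEngGeo5_of_klEngGeo4 {L M : ℕ} [NeZero L] [NeZero M] {P : SplitConsts} {Q : EngConsts} {β U μ : ℝ}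
    {K : TrigPolyC4v} {n : ℕ} (hK : 0 ≤ P.Klam) (h : EngineFirstMoments L M klEngGeo4 P Q β U μ K n) :
    EngineFirstMoments L M klEngGeo5 P Q β U μ K n :=
  engineFirstMoments_scaleGains_of _ hK h

end Summit.HubbardSuperconductivity.HubbardSuperconductivity.Theorems.EngineV8

end
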